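import Summits.MatrixMultiplication.MatrixMultiplication.Theorems.AbelianSTPPCensusTB3StatDefs

/-!
# T_B static certificate, range `5216 … 5590` (t*-indexed linear checker with the k-member tree at `τ = 2375/1000`): kernel evaluation, the completeness of the bucket lists, volumes `501 … 1000` (small volume chunks: the kernel recursion through the long low-`t` lists is bounded per theorem)

Cell mm-stpp (rung F-M1), tier T_B = «beat `2.375` (Coppersmith–Winograd)»; checker in `AbelianSTPPCensusTB3StatDefs.lean`, table and bucket lists in `AbelianSTPPCensusTB3StatData.lean`
(pattern: theory g12's `AbelianSTPPCensusTAStatDDom*/DCk*.lean`).  `decide` with kernel reduction (standard axioms; no `native_decide`), `Elab.async false`;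
consumed by `TB3Stat.checkV_sound` / `TB3Stat.domV_sound` / `TB3Stat.m2V_sound` in the leaf `AbelianSTPPCensusLeafTB5590Closed.lean`.
WHAT THIS IS NOT: arithmetic on shape lists only; no statement about STPP families or `ω`.
-/

set_option linter.dupNamespace false
set_option autoImplicit false
set_option Elab.async false

namespace Summit.MatrixMultiplication.MatrixMultiplication.Theorems.TB3Stat

set_option maxHeartbeats 0 in
/-- Completeness chunk: every sorted candidate shape of the volumes `501 … 550` lies in the list of the bucket of its `a·b` (308 shapes). [original] -/
theorem m2c501 : TB3Stat.m2V 50 501 = true := by decide +kernel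

set_option maxHeartbeats 0 in
/-- Completeness chunk: every sorted candidate shape of the volumes `551 … 600` lies in the list of the bucket of its `a·b` (323 shapes). [original] -/
theorem m2c551 : TB3Stat.m2V 50 551 = true := by decide +kernel

set_option maxHeartbeats 0 in
/-- Completeness chunk: every sorted candidate shape of the volumes `601 … 650` lies in the list of the bucket of its `a·b` (312 shapes). [original] -/
theorem m2c601 : TB3Stat.m2V 50 601 = true := by decide +kernel

set_option maxHeartbeats 0 in
/-- Completeness chunk: every sorted candidate shape of the volumes `651 … 700` lies in the list of the bucket of its `a·b` (312 shapes). [original] -/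
theorem m2c651 : TB3Stat.m2V 50 651 = true := by decide +kernel

set_option maxHeartbeats 0 in
/-- Completeness chunk: every sorted candidate shape of the volumes `701 … 750` lies in the list of the bucket of its `a·b` (326 shapes). [original] -/
theorem m2c701 : TB3Stat.m2V 50 701 = true := by decide +kernel

set_option maxHeartbeats 0 in
/-- Completeness chunk: every sorted candidate shape of the volumes `751 … 800` lies in the list of the bucket of its `a·b` (343 shapes). [original] -/
theorem m2c751 : TB3Stat.m2V 50 751 = true := by decide +kernel

set_option maxHeartbeats 0 in
/-- Completeness chunk: every sorted candidate shape of the volumes `801 … 850` lies in the list of the bucket of its `a·b` (327 shapes). [original] -/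
theorem m2c801 : TB3Stat.m2V 50 801 = true := by decide +kernel

set_option maxHeartbeats 0 in
/-- Completeness chunk: every sorted candidate shape of the volumes `851 … 900` lies in the list of the bucket of its `a·b` (356 shapes). [original] -/
theorem m2c851 : TB3Stat.m2V 50 851 = true := by decide +kernel

set_option maxHeartbeats 0 in
/-- Completeness chunk: every sorted candidate shape of the volumes `901 … 950` lies in the list of the bucket of its `a·b` (320 shapes). [original] -/
theorem m2c901 : TB3Stat.m2V 50 901 = true := by decide +kernel

set_option maxHeartbeats 0 in
/-- Completeness chunk: every sorted candidate shape of the volumes `951 … 1000` lies in the list of the bucket of its `a·b` (353 shapes). [original] -/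
theorem m2c951 : TB3Stat.m2V 50 951 = true := by decide +kernel

end Summit.MatrixMultiplication.MatrixMultiplication.Theorems.TB3Stat
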